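import Summits.AtomisticToContinuum.HydrodynamicLimit.Theorems.EnskogAdjointDualityAdjointEnskogTestFamilyRTelescopeProduct
import HarnessLib

/-!
# Defect split for the K2R Enskog defect, part 1: weighted integrability bookkeeping

Route `EnskogAdjointDuality` of `AtomisticToContinuum/HydrodynamicLimit`, crux K2R
`AdjointEnskogTestFamilyR` (stmt-AtomisticToContinuum-11592), line `birth`, stub G1 `stub_defectSplit`.

The defect split rewrites the Enskog defect of the Euler local Maxwellian tested on an admissible
family, `∫∫ f_tφ_t − ∫∫ f_0φ_0 − ∫₀ᵗ∫∫ f (Dφ + ½ Lφ)`, as the time integral of four terms (fluid,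
corrector, hydrodynamic transfer, corrector transfer).  Every kernel `h(s, x, v)` met on the way is
dominated by a constant multiple of the integrable weight `(1 + ‖v‖)⁻⁴` on `ℝ³` (decay `(1+‖v‖)⁻⁸` of
`f` and `Df` against growth at most `(1+‖v‖²)²` of the test side).  This file provides the generic
bookkeeping:

* `k2r_abs_mul_le_weight` — decay × growth is `≤ C_F K (1+‖v‖)⁻⁴`; `k2r_abs_le_of_defect` — the
  defect bound `|Dφ + Lφ| ≤ η(1+|v|²)` and the growth of `Lφ` bound `Dφ`;
* `k2r_continuous_hydroTestFn` — joint continuity of `α + β·v + γ|v|²/2`;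
* `k2r_integrable_v_of_abs_le`, `k2r_integrable_x_of_abs_le`, `k2r_integrableOn_s_of_abs_le` —
  integrability at the `v`-, `x`- (probability Haar measure on `𝕋³`) and `s`-level (`[0, t]`,
  the kernel agreeing on a full-measure subset with a measurable function of `(s, x, v)`);
* `k2r_defect_assembly` — the pure bookkeeping step: if `T = ∫₀ᵗ∫∫ H_A`, both `∫∫H_A`, `∫∫H_B` are
  integrable on `[0,t]`, all slices are integrable and `H_A − H_B = P₁ + λ⁻¹P₂ − ½P₃ − ½P₄` pointwise
  on `(0,t)`, then `T − ∫₀ᵗ∫∫ H_B = ∫₀ᵗ (∫∫P₁ + λ⁻¹∫∫P₂ − ½∫∫P₃ − ½∫∫P₄)` (registered sub-goal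
  `stub_defectSplit_assembly`).

References: H. Spohn, *Large Scale Dynamics of Interacting Particles* (1991), Part I §2.3
[Spohn1991]; folklore measure theory.
-/

noncomputable section

open MeasureTheory Metric Set Filter Topology Function
open scoped InnerProductSpace ENNReal

namespace Summit.AtomisticToContinuum.HydrodynamicLimit.Theorems.EnskogAdjointDuality

open Literature.Analysis.FluidPDE Literature.MathematicalPhysics.KineticTheory

/-! ## Elementary weight inequalities -/

/-- `(1 + ‖v‖²)² ≤ (1 + ‖v‖)⁴`. [folklore] -/
theorem k2r_one_add_norm_sq_sq_le (v : V3) : (1 + ‖v‖ ^ 2) ^ 2 ≤ (1 + ‖v‖) ^ 4 := by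
  calc (1 + ‖v‖ ^ 2) ^ 2 ≤ ((1 + ‖v‖) ^ 2) ^ 2 :=
        pow_le_pow_left₀ (by positivity) (k2r_one_add_norm_sq_le v) 2
    _ = (1 + ‖v‖) ^ 4 := by ring

/-- `1 + ‖v‖² ≤ (1 + ‖v‖)⁴`. [folklore] -/
theorem k2r_one_add_norm_sq_le_pow_four (v : V3) : 1 + ‖v‖ ^ 2 ≤ (1 + ‖v‖) ^ 4 := by
  have h1 : (1 : ℝ) ≤ 1 + ‖v‖ := by linarith [norm_nonneg v]
  exact (k2r_one_add_norm_sq_le v).trans (pow_le_pow_right₀ h1 (by norm_num))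

/-- **Decay × growth.** If `|a| (1+‖v‖)⁸ ≤ C_F` and `|b| ≤ K (1+‖v‖)⁴` then
`|a b| ≤ C_F K (1+‖v‖)⁻⁴`. [folklore] -/
theorem k2r_abs_mul_le_weight {a b CF K : ℝ} (v : V3) (ha : |a| * (1 + ‖v‖) ^ 8 ≤ CF)
    (hb : |b| ≤ K * (1 + ‖v‖) ^ 4) : |a * b| ≤ CF * K * ((1 + ‖v‖) ^ 4)⁻¹ := by
  have hJ : 0 < (1 + ‖v‖) ^ 4 := by positivity
  have hK : 0 ≤ K := le_of_mul_le_mul_right (by rw [zero_mul]; exact (abs_nonneg b).trans hb) hJ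
  calc |a * b| = |a| * |b| := abs_mul a b
    _ ≤ |a| * (K * (1 + ‖v‖) ^ 4) := mul_le_mul_of_nonneg_left hb (abs_nonneg a)
    _ = |a| * (1 + ‖v‖) ^ 8 * (K * ((1 + ‖v‖) ^ 4)⁻¹) := by
        rw [show (1 + ‖v‖) ^ 8 = (1 + ‖v‖) ^ 4 * (1 + ‖v‖) ^ 4 by ring]
        field_simp
    _ ≤ CF * (K * ((1 + ‖v‖) ^ 4)⁻¹) :=
        mul_le_mul_of_nonneg_right ha (mul_nonneg hK (inv_nonneg.2 hJ.le))
    _ = CF * K * ((1 + ‖v‖) ^ 4)⁻¹ := by ring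

/-- Symmetric form of `k2r_abs_mul_le_weight`: growth × decay. [folklore] -/
theorem k2r_abs_mul_le_weight' {a b CF K : ℝ} (v : V3) (ha : |a| * (1 + ‖v‖) ^ 8 ≤ CF)
    (hb : |b| ≤ K * (1 + ‖v‖) ^ 4) : |b * a| ≤ CF * K * ((1 + ‖v‖) ^ 4)⁻¹ := by
  rw [mul_comm]; exact k2r_abs_mul_le_weight v ha hb

/-! ## Weighted integrability: `v`-, `x`- and `s`-levels -/

/-- `v`-level: a measurable kernel dominated by `K (1+‖v‖)⁻⁴` is integrable on `ℝ³`, with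
`|∫ g| ≤ K ∫ (1+‖v‖)⁻⁴`. [folklore] -/
theorem k2r_integrable_v_of_abs_le {g : V3 → ℝ} (hg : AEStronglyMeasurable g volume) {K : ℝ}
    (hK : ∀ v, |g v| ≤ K * ((1 + ‖v‖) ^ 4)⁻¹) :
    Integrable g ∧ |∫ v, g v| ≤ K * ∫ v : V3, ((1 + ‖v‖) ^ 4)⁻¹ := by
  have hdom : Integrable (fun v : V3 => K * ((1 + ‖v‖) ^ 4)⁻¹) :=
    k2r_integrable_inv_one_add_norm_pow_four.const_mul K
  have hle : ∀ᵐ v ∂(volume : Measure V3), ‖g v‖ ≤ K * ((1 + ‖v‖) ^ 4)⁻¹ :=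
    Eventually.of_forall fun v => by rw [Real.norm_eq_abs]; exact hK v
  refine ⟨hdom.mono' hg hle, ?_⟩
  have h := norm_integral_le_of_norm_le hdom hle
  rwa [Real.norm_eq_abs, integral_const_mul] at h

/-- `x`-level: for a jointly measurable kernel `H` on `𝕋³ × ℝ³` with `|H(x, v)| ≤ K (1+‖v‖)⁻⁴`, every
slice `H(x, ·)` is integrable, `x ↦ ∫ H(x, v) dv` is integrable on `𝕋³`, and
`|∫∫ H| ≤ K ∫ (1+‖v‖)⁻⁴`. [folklore] -/
theorem k2r_integrable_x_of_abs_le {H : T3 → V3 → ℝ} (hHm : Measurable fun q : T3 × V3 => H q.1 q.2)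
    {K : ℝ} (hK : ∀ x v, |H x v| ≤ K * ((1 + ‖v‖) ^ 4)⁻¹) :
    (∀ x, Integrable (H x)) ∧ Integrable (fun x => ∫ v, H x v) ∧
      |∫ x, ∫ v, H x v| ≤ K * ∫ v : V3, ((1 + ‖v‖) ^ 4)⁻¹ := by
  have hsm : StronglyMeasurable fun q : T3 × V3 => H q.1 q.2 := hHm.stronglyMeasurable
  have hint : StronglyMeasurable fun x : T3 => ∫ v, H x v := hsm.integral_prod_right'
  have hv : ∀ x, Integrable (H x) ∧ |∫ v, H x v| ≤ K * ∫ v : V3, ((1 + ‖v‖) ^ 4)⁻¹ := fun x =>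
    k2r_integrable_v_of_abs_le
      (hHm.comp (measurable_const.prodMk measurable_id)).aestronglyMeasurable (hK x)
  refine ⟨fun x => (hv x).1, ?_, ?_⟩
  · exact (integrable_const (K * ∫ v : V3, ((1 + ‖v‖) ^ 4)⁻¹)).mono' hint.aestronglyMeasurable
      (Eventually.of_forall fun x => by rw [Real.norm_eq_abs]; exact (hv x).2)
  · have h := norm_integral_le_of_norm_le (integrable_const (K * ∫ v : V3, ((1 + ‖v‖) ^ 4)⁻¹))
      (Eventually.of_forall fun x => by rw [Real.norm_eq_abs]; exact (hv x).2)
      (f := fun x : T3 => ∫ v, H x v) (μ := volume)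
    rw [integral_const, smul_eq_mul, probReal_univ, one_mul, Real.norm_eq_abs] at h
    exact h

/-- `s`-level: if the kernel `H(s, x, v)` agrees, for `s` in a full-measure subset `S ⊆ [0, t]`,
with a measurable function of `(s, x, v)` and satisfies `|H(s, x, v)| ≤ K (1+‖v‖)⁻⁴` there, then
`s ↦ ∫∫ H(s, ·, ·)` is integrable on `[0, t]`, and for `s ∈ S` all slices are integrable with
`|∫∫ H(s, ·, ·)| ≤ K ∫ (1+‖v‖)⁻⁴`. [folklore] -/
theorem k2r_integrableOn_s_of_abs_le {t : ℝ} {H : ℝ → T3 → V3 → ℝ} {Hm : ℝ × T3 × V3 → ℝ}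
    (hHm : Measurable Hm) {S : Set ℝ} (hSae : ∀ᵐ s ∂(volume.restrict (Icc 0 t)), s ∈ S)
    (hH : ∀ s ∈ S, ∀ x v, H s x v = Hm (s, x, v)) {K : ℝ}
    (hK : ∀ s ∈ S, ∀ x v, |H s x v| ≤ K * ((1 + ‖v‖) ^ 4)⁻¹) :
    IntegrableOn (fun s => ∫ x, ∫ v, H s x v) (Icc 0 t) ∧
      ∀ s ∈ S, (∀ x, Integrable (H s x)) ∧ Integrable (fun x => ∫ v, H s x v) ∧
        |∫ x, ∫ v, H s x v| ≤ K * ∫ v : V3, ((1 + ‖v‖) ^ 4)⁻¹ := by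
  have hslice : ∀ s ∈ S, (∀ x, Integrable (H s x)) ∧ Integrable (fun x => ∫ v, H s x v) ∧
      |∫ x, ∫ v, H s x v| ≤ K * ∫ v : V3, ((1 + ‖v‖) ^ 4)⁻¹ := by
    intro s hs
    have hm : Measurable fun q : T3 × V3 => H s q.1 q.2 := by
      have : (fun q : T3 × V3 => H s q.1 q.2) = fun q => Hm (s, q.1, q.2) := by
        funext q; exact hH s hs q.1 q.2
      rw [this]
      exact hHm.comp (measurable_const.prodMk measurable_id)
    exact k2r_integrable_x_of_abs_le hm (hK s hs)
  refine ⟨?_, hslice⟩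
  have hsm : StronglyMeasurable fun q : (ℝ × T3) × V3 => Hm (q.1.1, q.1.2, q.2) := by
    have hre : Measurable fun q : (ℝ × T3) × V3 => ((q.1.1, q.1.2, q.2) : ℝ × T3 × V3) := by
      fun_prop
    exact (hHm.comp hre).stronglyMeasurable
  have h1 : StronglyMeasurable fun q : ℝ × T3 => ∫ v, Hm (q.1, q.2, v) := hsm.integral_prod_right'
  have h2 : StronglyMeasurable fun s : ℝ => ∫ x, ∫ v, Hm (s, x, v) := h1.integral_prod_right'
  have hae : (fun s => ∫ x, ∫ v, H s x v) =ᵐ[volume.restrict (Icc 0 t)]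
      fun s => ∫ x, ∫ v, Hm (s, x, v) := by
    filter_upwards [hSae] with s hs
    simp_rw [hH s hs]
  refine Integrable.congr ?_ hae.symm
  refine (integrable_const (K * ∫ v : V3, ((1 + ‖v‖) ^ 4)⁻¹)).mono' h2.aestronglyMeasurable ?_
  filter_upwards [hSae] with s hs
  rw [Real.norm_eq_abs]
  have : (∫ x, ∫ v, Hm (s, x, v)) = ∫ x, ∫ v, H s x v := by simp_rw [hH s hs]
  rw [this]
  exact (hslice s hs).2.2

/-! ## Growth bounds for the characteristic derivative of the test function -/

/-- From the defect bound `|D + L| ≤ η (1+|v|²)` and the growth `|L| ≤ K (1+|v|²)²` to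
`|D| ≤ (|η| + K)(1+|v|²)²`. [folklore] -/
theorem k2r_abs_le_of_defect {D L η K : ℝ} (v : V3) (h1 : |D + L| ≤ η * (1 + ‖v‖ ^ 2))
    (h2 : |L| ≤ K * (1 + ‖v‖ ^ 2) ^ 2) : |D| ≤ (|η| + K) * (1 + ‖v‖ ^ 2) ^ 2 := by
  have hq : (1 : ℝ) ≤ 1 + ‖v‖ ^ 2 := by nlinarith [sq_nonneg ‖v‖]
  have hone : (1 + ‖v‖ ^ 2) ≤ (1 + ‖v‖ ^ 2) ^ 2 := le_self_pow₀ hq two_ne_zero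
  calc |D| = |(D + L) - L| := by rw [add_sub_cancel_right]
    _ ≤ |D + L| + |L| := abs_sub _ _
    _ ≤ η * (1 + ‖v‖ ^ 2) + K * (1 + ‖v‖ ^ 2) ^ 2 := add_le_add h1 h2
    _ ≤ |η| * (1 + ‖v‖ ^ 2) + K * (1 + ‖v‖ ^ 2) ^ 2 := by gcongr; exact le_abs_self η
    _ ≤ |η| * (1 + ‖v‖ ^ 2) ^ 2 + K * (1 + ‖v‖ ^ 2) ^ 2 := by gcongr
    _ = (|η| + K) * (1 + ‖v‖ ^ 2) ^ 2 := by ring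

/-- `|D + ½ L| ≤ (B + K/2)(1+‖v‖)⁴` from `|D| ≤ B (1+‖v‖)⁴`, `|L| ≤ K (1+‖v‖)⁴`. [folklore] -/
theorem k2r_abs_add_half_le {D L B K : ℝ} (v : V3) (h1 : |D| ≤ B * (1 + ‖v‖) ^ 4)
    (h2 : |L| ≤ K * (1 + ‖v‖) ^ 4) : |D + (1 / 2 : ℝ) * L| ≤ (B + K / 2) * (1 + ‖v‖) ^ 4 := by
  calc |D + (1 / 2 : ℝ) * L| ≤ |D| + |(1 / 2 : ℝ) * L| := abs_add_le _ _
    _ = |D| + (1 / 2 : ℝ) * |L| := by rw [abs_mul, abs_of_pos (by norm_num : (0 : ℝ) < 1 / 2)]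
    _ ≤ B * (1 + ‖v‖) ^ 4 + (1 / 2 : ℝ) * (K * (1 + ‖v‖) ^ 4) := by gcongr
    _ = (B + K / 2) * (1 + ‖v‖) ^ 4 := by ring

/-! ## Continuity of the hydrodynamic test function -/

/-- The hydrodynamic test function `ψ(s, x, v) = α + ⟪β, v⟫ + γ |v|²/2` of a continuous coefficient
field `c = (α, β, γ)` is jointly continuous in `(s, x, v)`. [folklore] -/
theorem k2r_continuous_hydroTestFn {c : ℝ → T3 → ℝ × V3 × ℝ} (hc : Continuous (uncurry c))
    {ψ : ℝ → T3 → V3 → ℝ}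
    (hψ : ∀ s x v, ψ s x v = (c s x).1 + ⟪(c s x).2.1, v⟫_ℝ + (c s x).2.2 * ‖v‖ ^ 2 / 2) :
    Continuous fun p : ℝ × T3 × V3 => ψ p.1 p.2.1 p.2.2 := by
  have hcN : Continuous fun p : ℝ × T3 × V3 => c p.1 p.2.1 :=
    hc.comp (continuous_fst.prodMk continuous_snd.fst)
  have h1c : Continuous fun p : ℝ × T3 × V3 => (c p.1 p.2.1).1 := continuous_fst.comp hcN
  have h21 : Continuous fun p : ℝ × T3 × V3 => (c p.1 p.2.1).2.1 :=
    continuous_fst.comp (continuous_snd.comp hcN)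
  have h22 : Continuous fun p : ℝ × T3 × V3 => (c p.1 p.2.1).2.2 :=
    continuous_snd.comp (continuous_snd.comp hcN)
  have e : (fun p : ℝ × T3 × V3 => ψ p.1 p.2.1 p.2.2) = fun p => (c p.1 p.2.1).1 +
      ⟪(c p.1 p.2.1).2.1, p.2.2⟫_ℝ + (c p.1 p.2.1).2.2 * ‖p.2.2‖ ^ 2 / 2 := funext fun p => hψ _ _ _
  rw [e]
  exact (h1c.add (h21.inner continuous_snd.snd)).add
    ((h22.mul (continuous_snd.snd.norm.pow 2)).div_const 2)

/-! ## The open window has full measure in `[0, t]` -/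

/-- Almost every `s ∈ [0, t]` lies in `(0, t)`. [folklore] -/
theorem k2r_ae_mem_Ioo (t : ℝ) : ∀ᵐ s ∂(volume : Measure ℝ), s ∈ Icc 0 t → s ∈ Ioo 0 t := by
  have hnull : volume ({0, t} : Set ℝ) = 0 := ((Set.finite_singleton t).insert 0).measure_zero _
  filter_upwards [compl_mem_ae_iff.2 hnull] with s hs hsI
  simp only [mem_compl_iff, mem_insert_iff, mem_singleton_iff, not_or] at hs
  exact ⟨lt_of_le_of_ne hsI.1 (Ne.symm hs.1), lt_of_le_of_ne hsI.2 hs.2⟩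

/-- Almost every `s` of `[0, t]` (restricted Lebesgue measure) lies in `(0, t)`. [folklore] -/
theorem k2r_ae_restrict_mem_Ioo (t : ℝ) : ∀ᵐ s ∂(volume.restrict (Icc 0 t)), s ∈ Ioo 0 t := by
  rw [ae_restrict_iff' measurableSet_Icc]
  exact k2r_ae_mem_Ioo t

/-! ## The bookkeeping step -/

/-- **Assembly of the defect split (pure bookkeeping).** If `T = ∫₀ᵗ∫∫ H_A`, the maps `s ↦ ∫∫H_A(s)`,
`s ↦ ∫∫H_B(s)` are integrable on `[0, t]`, for `s ∈ (0, t)` all `x`- and `v`-slices of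
`H_A, H_B, P₁, …, P₄` are integrable, and pointwise on `(0, t) × 𝕋³ × ℝ³`
`H_A − H_B = P₁ + λ⁻¹ P₂ − ½ P₃ − ½ P₄`, then
`T − ∫₀ᵗ∫∫ H_B = ∫₀ᵗ (∫∫P₁ + λ⁻¹ ∫∫P₂ − ½ ∫∫P₃ − ½ ∫∫P₄)`. [folklore] -/
theorem k2r_defect_assembly {t T lamInv : ℝ} {HA HB P₁ P₂ P₃ P₄ : ℝ → T3 → V3 → ℝ}
    (hT : T = ∫ s in Icc 0 t, ∫ x, ∫ v, HA s x v)
    (hAs : IntegrableOn (fun s => ∫ x, ∫ v, HA s x v) (Icc 0 t))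
    (hBs : IntegrableOn (fun s => ∫ x, ∫ v, HB s x v) (Icc 0 t))
    (hAx : ∀ s ∈ Ioo 0 t, (∀ x, Integrable (HA s x)) ∧ Integrable (fun x => ∫ v, HA s x v))
    (hBx : ∀ s ∈ Ioo 0 t, (∀ x, Integrable (HB s x)) ∧ Integrable (fun x => ∫ v, HB s x v))
    (h₁ : ∀ s ∈ Ioo 0 t, (∀ x, Integrable (P₁ s x)) ∧ Integrable (fun x => ∫ v, P₁ s x v))
    (h₂ : ∀ s ∈ Ioo 0 t, (∀ x, Integrable (P₂ s x)) ∧ Integrable (fun x => ∫ v, P₂ s x v))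
    (h₃ : ∀ s ∈ Ioo 0 t, (∀ x, Integrable (P₃ s x)) ∧ Integrable (fun x => ∫ v, P₃ s x v))
    (h₄ : ∀ s ∈ Ioo 0 t, (∀ x, Integrable (P₄ s x)) ∧ Integrable (fun x => ∫ v, P₄ s x v))
    (hpt : ∀ s ∈ Ioo 0 t, ∀ x v, HA s x v - HB s x v =
      P₁ s x v + lamInv * P₂ s x v - (1 / 2 : ℝ) * P₃ s x v - (1 / 2 : ℝ) * P₄ s x v) :
    T - (∫ s in Icc 0 t, ∫ x, ∫ v, HB s x v) =
      ∫ s in Icc 0 t, ((∫ x, ∫ v, P₁ s x v) + lamInv * (∫ x, ∫ v, P₂ s x v) -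
        (1 / 2 : ℝ) * (∫ x, ∫ v, P₃ s x v) - (1 / 2 : ℝ) * (∫ x, ∫ v, P₄ s x v)) := by
  rw [hT, ← integral_sub hAs hBs]
  refine setIntegral_congr_ae measurableSet_Icc ?_
  filter_upwards [k2r_ae_mem_Ioo t] with s hs hsI
  have hso := hs hsI
  obtain ⟨hAv, hAx'⟩ := hAx s hso
  obtain ⟨hBv, hBx'⟩ := hBx s hso
  obtain ⟨h1v, h1x⟩ := h₁ s hso
  obtain ⟨h2v, h2x⟩ := h₂ s hso
  obtain ⟨h3v, h3x⟩ := h₃ s hso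
  obtain ⟨h4v, h4x⟩ := h₄ s hso
  -- the `v`-level
  have hv : ∀ x, (∫ v, HA s x v) - (∫ v, HB s x v) =
      (∫ v, P₁ s x v) + lamInv * (∫ v, P₂ s x v) - (1 / 2 : ℝ) * (∫ v, P₃ s x v) -
        (1 / 2 : ℝ) * (∫ v, P₄ s x v) := by
    intro x
    have hI₂ : Integrable (fun v => lamInv * P₂ s x v) := (h2v x).const_mul lamInv
    have hI₃ : Integrable (fun v => (1 / 2 : ℝ) * P₃ s x v) := (h3v x).const_mul _
    have hI₄ : Integrable (fun v => (1 / 2 : ℝ) * P₄ s x v) := (h4v x).const_mul _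
    have hI₁₂ : Integrable (fun v => P₁ s x v + lamInv * P₂ s x v) := (h1v x).add hI₂
    have hI₁₂₃ : Integrable (fun v => P₁ s x v + lamInv * P₂ s x v - (1 / 2 : ℝ) * P₃ s x v) :=
      hI₁₂.sub hI₃
    have hfun : (fun v => HA s x v - HB s x v) =
        fun v => P₁ s x v + lamInv * P₂ s x v - (1 / 2 : ℝ) * P₃ s x v - (1 / 2 : ℝ) * P₄ s x v :=
      funext (hpt s hso x)
    rw [← integral_sub (hAv x) (hBv x), hfun, integral_sub hI₁₂₃ hI₄, integral_sub hI₁₂ hI₃,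
      integral_add (h1v x) hI₂, integral_const_mul, integral_const_mul, integral_const_mul]
  -- the `x`-level
  have hJ₂ : Integrable (fun x => lamInv * ∫ v, P₂ s x v) := h2x.const_mul lamInv
  have hJ₃ : Integrable (fun x => (1 / 2 : ℝ) * ∫ v, P₃ s x v) := h3x.const_mul _
  have hJ₄ : Integrable (fun x => (1 / 2 : ℝ) * ∫ v, P₄ s x v) := h4x.const_mul _
  have hJ₁₂ : Integrable (fun x => (∫ v, P₁ s x v) + lamInv * ∫ v, P₂ s x v) := h1x.add hJ₂
  have hJ₁₂₃ : Integrable (fun x => (∫ v, P₁ s x v) + lamInv * (∫ v, P₂ s x v) -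
      (1 / 2 : ℝ) * ∫ v, P₃ s x v) := hJ₁₂.sub hJ₃
  have hfun : (fun x => (∫ v, HA s x v) - ∫ v, HB s x v) = fun x => (∫ v, P₁ s x v) +
      lamInv * (∫ v, P₂ s x v) - (1 / 2 : ℝ) * (∫ v, P₃ s x v) - (1 / 2 : ℝ) * (∫ v, P₄ s x v) :=
    funext hv
  rw [← integral_sub hAx' hBx', hfun, integral_sub hJ₁₂₃ hJ₄, integral_sub hJ₁₂ hJ₃,
    integral_add h1x hJ₂, integral_const_mul, integral_const_mul, integral_const_mul]

/-! ## Registered sub-goal of stub `stub_defectSplit` proved in this file -/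

/-- **Registered sub-goal `stub_defectSplit_assembly`** (K2R line `birth`, stub G1, part 1): the
bookkeeping step `k2r_defect_assembly`, as a closed statement. [folklore] -/
theorem stub_defectSplit_assembly :
    ∀ (t T lamInv : ℝ) (HA HB P₁ P₂ P₃ P₄ : ℝ → UnitAddTorus (Fin 3) → EuclideanSpace ℝ (Fin 3) → ℝ), T = ∫
      s in Set.Icc 0 t, ∫ x : UnitAddTorus (Fin 3), ∫ v : EuclideanSpace ℝ (Fin 3), HA s x v →
      MeasureTheory.IntegrableOn (fun s => ∫ x : UnitAddTorus (Fin 3), ∫ v : EuclideanSpace ℝ (Fin 3), HA s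
      x v) (Set.Icc 0 t) → MeasureTheory.IntegrableOn (fun s => ∫ x : UnitAddTorus (Fin 3), ∫ v :
      EuclideanSpace ℝ (Fin 3), HB s x v) (Set.Icc 0 t) → (∀ s ∈ Set.Ioo 0 t, ((∀ x,
      MeasureTheory.Integrable (HA s x)) ∧ MeasureTheory.Integrable (fun x => ∫ v, HA s x v)) ∧ ((∀ x,
      MeasureTheory.Integrable (HB s x)) ∧ MeasureTheory.Integrable (fun x => ∫ v, HB s x v)) ∧ ((∀ x,
      MeasureTheory.Integrable (P₁ s x)) ∧ MeasureTheory.Integrable (fun x => ∫ v, P₁ s x v)) ∧ ((∀ x,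
      MeasureTheory.Integrable (P₂ s x)) ∧ MeasureTheory.Integrable (fun x => ∫ v, P₂ s x v)) ∧ ((∀ x,
      MeasureTheory.Integrable (P₃ s x)) ∧ MeasureTheory.Integrable (fun x => ∫ v, P₃ s x v)) ∧ ((∀ x,
      MeasureTheory.Integrable (P₄ s x)) ∧ MeasureTheory.Integrable (fun x => ∫ v, P₄ s x v))) → (∀ s ∈
      Set.Ioo 0 t, ∀ x v, HA s x v - HB s x v = P₁ s x v + lamInv * P₂ s x v - (1 / 2 : ℝ) * P₃ s x v - (1 /
      2 : ℝ) * P₄ s x v) → T - (∫ s in Set.Icc 0 t, ∫ x : UnitAddTorus (Fin 3), ∫ v : EuclideanSpace ℝ (Fin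
      3), HB s x v) = ∫ s in Set.Icc 0 t, ((∫ x : UnitAddTorus (Fin 3), ∫ v : EuclideanSpace ℝ (Fin 3), P₁ s
      x v) + lamInv * (∫ x : UnitAddTorus (Fin 3), ∫ v : EuclideanSpace ℝ (Fin 3), P₂ s x v) - (1 / 2 : ℝ) *
      (∫ x : UnitAddTorus (Fin 3), ∫ v : EuclideanSpace ℝ (Fin 3), P₃ s x v) - (1 / 2 : ℝ) * (∫ x :
      UnitAddTorus (Fin 3), ∫ v : EuclideanSpace ℝ (Fin 3), P₄ s x v)) := by
  intro t T lamInv HA HB P₁ P₂ P₃ P₄ hT hAs hBs hsl hpt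
  exact k2r_defect_assembly hT hAs hBs (fun s hs => (hsl s hs).1) (fun s hs => (hsl s hs).2.1)
    (fun s hs => (hsl s hs).2.2.1) (fun s hs => (hsl s hs).2.2.2.1) (fun s hs => (hsl s hs).2.2.2.2.1)
    (fun s hs => (hsl s hs).2.2.2.2.2) hpt

end Summit.AtomisticToContinuum.HydrodynamicLimit.Theorems.EnskogAdjointDuality

end
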